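import Summits.BirchSwinnertonDyer.BirchSwinnertonDyer.Theorems.PrintX11aLowerHalfFiveOfGreenbergRankZero
import Summits.BirchSwinnertonDyer.BirchSwinnertonDyer.Theorems.PrintX11aLowerHalfThreeMazurCore
import HarnessLib

/-!
# Crux `X11aLowerHalf` (item stmt-BirchSwinnertonDyer-19064) at `p = 3`, and the whole crux in line r17's shape, WITHOUT
# Stein–Wuthrich Thm. 6.1 — the partner road and the très-ramifié door re-issued over Greenberg's rank-`0` formula
# (width seat bsd-line-er5-p2 = -w3, gen 14; `--supports stmt-BirchSwinnertonDyer-19064` helper; no registry verb; the lead decides)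

HONEST FRAMING.  Composition theorems only; no definition, no named fact minted, no `sorry`.  Every theorem is
CONDITIONAL on its displayed binders and closes nothing by itself; the two research statements of line «birth» r17
(`hMC5` = `stub_mazurMCAtDeepFive`, `hMC3` = `stub_mazurMCAtTresRamifieThree`: Mazur's cyclotomic main conjecture at the
deep X11a pairs with `p ≥ 5`, resp. at the très-ramifié deep pairs with `p = 3`; OPEN in print without a (ram) prime) stay
OPEN and DISPLAYED.  No summit statement is proved; BSD is proved for no curve and no class.

WHY.  The companion `PrintX11aLowerHalfFiveOfGreenbergRankZero` (p666636) replaced the two Stein–Wuthrich Thm. 6.1 binders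
by Greenberg's rank-`0` formula (`Greenberg1999.thm41Analogue_charValue_rankZero_{split_baseChange_anyPrime,numberField}`,
via the INPUT seats' slices p662964 ∕ p664420) on the `p ≥ 5` slice of crux L.  At `p = 3` the line's two roads consume
SW 6.1 ONLY at their last step `X2.MazurMainConjectureAt W 3 ⟹ BSD(E,3)` (`bsdp_of_mazurMainConjectureAt_heightFree` in
`ClassX11a.missingLowerBoundAt_three_of_partner_of_multDivisibilityAt_of_theoremB`, p646859's lineage; and the five-fact
door at a très-ramifié pair), so the same replacement goes through verbatim:
* §1 the finite-flat PARTNER road (`E[3] ≃ A[3]`, `A` good ordinary at `3`; EPW Cor. 5.1.4 ∕ Yan–Zhu 4.9 ∕ EPW Thm. 1 alg,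
  Mazur 4.1, the Kato packages for the typed divisibility) with the Greenberg binders: `…_of_theoremB_of_greenberg` ×2;
* §2 the `p = 3` deep statement `lowerThreeDeep_…` and item 23178's text `lowerAtThree_…` (`∀ V, ClassX11a V 3 →
  MissingLowerBoundAt V 3`, = the lead's r18 child `stub_x11aLowerHalfAtThree`) from r17's `p = 3` children with SW 6.1
  replaced — compare the lead's turnkey `Birth.lowerAtThree_of_children_r17_three (h9) (h2L) (hQ3) (hMC3)` (p663752);
* §3 crux L BY NAME (`Theses.PrintX11a.X11aLowerHalf`) from r17's FIVE children with the shared nine's two SW 6.1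
  conjuncts replaced by the two Greenberg facts — i.e. Stein–Wuthrich Thm. 6.1 leaves crux L's ENTIRE cone (both `p = 3`
  roads and the `p ≥ 5` slice); 14 named facts stay 14: {modularity, GS, Kato 12.4, Kato §17.13 `_contra` ×3, Mazur 4.1,
  Greenberg §4 ×2, Kato–Wuthrich A32, GZK, EPW 5.1.4, Yan–Zhu 4.9, EPW Thm. 1 alg} + the two research statements.
An OPTION for the lead ∕ planner (W-81′ booking without SW 6.1), not a reshape.

References: [GreenbergLNM1716] §4 (pp. 112–113), §3 p. 94; [EmertonPollackWeston2006] Thm. 1, Cor. 5.1.4;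
[YanZhu2024MainConjNonCM] Thm. 4.9; [Kato2004Asterisque] Thm. 12.4, §17.13; [Wuthrich2014] Thm. 3, Lemma 20; [Mazur1978]
Cor. 4.1; [Skinner2016PacificMC] Thm. A (shape only); [Miller2011LMS] Def. 1.1; tree p666636, p646859, p657610, p663752,
`Cruxes/X11aLowerHalf/Lines/birth.lean` (r17).
-/

set_option autoImplicit false
set_option linter.dupNamespace false -- the directory name repeats the summit name (sibling precedent)

noncomputable section

open scoped Classical MatrixGroups ModularForm

open CongruenceSubgroup UpperHalfPlane WeierstrassCurve IsDedekindDomain Rat.HeightOneSpectrum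
  Literature.NumberTheory.EllipticCurves
  Literature.NumberTheory.EllipticCurves.ModularForms
  Literature.NumberTheory.EllipticCurves.Rank1Residual
  Literature.NumberTheory.EllipticCurves.Rank1Residual.Typed
  Literature.NumberTheory.EllipticCurves.Wuthrich2014
  Literature.NumberTheory.EllipticCurves.SteinWuthrich2013
  Literature.NumberTheory.EllipticCurves.Greenberg1999
  Literature.NumberTheory.EllipticCurves.Kato2004
  Literature.NumberTheory.EllipticCurves.GreenbergVatsal2000
  Literature.NumberTheory.EllipticCurves.EmertonPollackWeston2006
  Literature.NumberTheory.EllipticCurves.SkinnerUrban2014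
  Literature.NumberTheory.EllipticCurves.BalakrishnanEtAl2019
  Literature.NumberTheory.GaloisRepresentations
  Literature.NumberTheory.Automorphic
  Summit.BirchSwinnertonDyer.Rank1Residual
  Summit.BirchSwinnertonDyer.Rank1Residual.X11a
  Summit.BirchSwinnertonDyer.BirchSwinnertonDyer.Theorems.OddChain
  Summit.BirchSwinnertonDyer.BirchSwinnertonDyer.Theorems.ThreePartner

namespace Summit.BirchSwinnertonDyer.BirchSwinnertonDyer.Theorems.GreenbergRankZero

/-! ### §1 The finite-flat partner road at `p = 3` without Stein–Wuthrich Thm. 6.1 -/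

section Doors

variable {W : WeierstrassCurve ℚ} [W.IsElliptic] [W.IsGloballyMinimal] {p : ℕ} [Fact p.Prime]
  (A : WeierstrassCurve ℚ) [A.IsElliptic] [A.IsGloballyMinimal]

/-- **The lower half at an X11a pair with `p = 3`, EITHER image, from a good-ordinary `3`-congruent partner `A`, the typed
divisibility `hdiv` and named facts — Greenberg's rank-`0` formula ×2 (`hGs`, `hGn`) in place of Stein–Wuthrich 6.1 ×2.**
Verbatim `ClassX11a.missingLowerBoundAt_three_of_partner_of_multDivisibilityAt_of_theoremB` (THREE partner facts EPW
Cor. 5.1.4 ∕ Yan–Zhu 4.9 ∕ EPW Thm. 1 alg, Mazur 4.1 for `μ^an(E,3) = 0`, GZK, GS at the pair, modularity): Mazur's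
statement at `(E,3)` by `mazurMainConjectureAt_of_multiplicativeCharIdealMuZero`, then `BSD(E,3)` by
`bsdp_of_mazurMainConjectureAt_of_analyticRank_eq_zero_of_greenberg` (p666636 §2).  PER PAIR; CONDITIONAL.
[cite: EmertonPollackWeston2006, Thm. 1, Cor. 5.1.4] [cite: YanZhu2024MainConjNonCM, Thm. 4.9] [cite: Mazur1978, Cor. 4.1]
[cite: GreenbergLNM1716, §4 (pp. 112–113)] [cite: Miller2011LMS, Def. 1.1] -/
theorem _root_.Summit.BirchSwinnertonDyer.Rank1Residual.ClassX11a.missingLowerBoundAt_three_of_partner_of_multDivisibilityAt_of_theoremB_of_greenberg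
    (hNf : exists_isNewformOf) (hEPW : cor514_transfer_of_goodOrdinary_odd)
    (hYZ : YanZhu2026.thm49_charIdeal_eq_padicLFunction) (hTa : thm1_muAlg_transfer_goodOrdinary_of_mult_odd)
    (hMz : mazur_not_dvd_maninConstant_of_odd)
    (hGs : Greenberg1999.thm41Analogue_charValue_rankZero_split_baseChange_anyPrime)
    (hGn : Greenberg1999.thm41Analogue_charValue_rankZero_numberField)
    (hGZK : rank_eq_analyticRank_of_analyticRank_le_one) (hGS : greenberg_stevens (W := W) (p := p))
    (hX : ClassX11a W p) (hp3 : p = 3) (hdiv : X11b.MultDivisibilityAt W p)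
    (hgoodA : A.HasGoodReductionAtPrime p) (hordA : ¬ (p : ℤ) ∣ A.frobeniusTrace p)
    (hiso : ∃ e : geomTorsion W (p : ℤ) ≃+ geomTorsion A (p : ℤ),
      ∀ (σ : Field.absoluteGaloisGroup ℚ) (P : geomTorsion W (p : ℤ)), e (σ • P) = σ • e P) :
    MissingLowerBoundAt W p := by
  subst hp3
  have hmod : hasEntireLFunction_rat := hasEntireLFunction_rat_of_exists_isNewformOf hNf
  have hpar : nonempty_modularParametrizationData :=
    nonempty_modularParametrizationData_of_exists_isNewformOf hNf
      IsNewformOf.exists_maninConstant_ne_zero_holds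
  have hμ : X11a.MuAnZeroAt W 3 := MultThreeMuAn.muAnZeroAt_three_of_mult_of_irr hMz W hX.mult hX.irr
  have hMC : X2.MazurMainConjectureAt W 3 :=
    mazurMainConjectureAt_of_multiplicativeCharIdealMuZero W 3
      (multiplicativeCharIdealMuZero_three_of_partner_of_theoremB W A hEPW hYZ hTa hMz hpar hX.mult hX.irr hdiv hμ
        hgoodA hordA hiso)
  exact hX.missingLowerBoundAt_of_bsdp hGZK
    (bsdp_of_mazurMainConjectureAt_of_analyticRank_eq_zero_of_greenberg hGs hGn hGZK hmod hpar W 3 hGS hX.ne_two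
      hX.mult hX.1 hMC)

/-- **The lower half at an X11a pair with `p = 3`, ANY image, from a good-ordinary `3`-congruent partner and PRINT-EXACT named
facts — Greenberg's rank-`0` formula ×2 in place of Stein–Wuthrich 6.1 ×2.**  Verbatim
`ClassX11a.missingLowerBoundAt_three_of_partner_of_contraFacts_of_theoremB`: surjective side through Kato–Wuthrich A32
(`hKato`) + Wuthrich's Lemma 20 (`h20`), non-surjective side through Kato 12.4 + §17.13 V′ ∕ VI′ ∕ XI′ `_contra` and Mazur 4.1;
then §1.  PER PAIR; CONDITIONAL.
[cite: Kato2004Asterisque, Thm. 12.4 (p. 221), §17.13 (pp. 279–280)] [cite: Wuthrich2014, Thm. 3, Lemma 20 (p. 399)]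
[cite: GreenbergLNM1716, §4 (pp. 112–113)] [cite: Miller2011LMS, Def. 1.1] -/
theorem _root_.Summit.BirchSwinnertonDyer.Rank1Residual.ClassX11a.missingLowerBoundAt_three_of_partner_of_contraFacts_of_theoremB_of_greenberg
    (hNf : exists_isNewformOf) (hEPW : cor514_transfer_of_goodOrdinary_odd)
    (hYZ : YanZhu2026.thm49_charIdeal_eq_padicLFunction) (hTa : thm1_muAlg_transfer_goodOrdinary_of_mult_odd)
    (hMz : mazur_not_dvd_maninConstant_of_odd)
    (hKato : kato_charIdeal_dvd_multiplicative_of_surjective) (h20 : lemma20_surjective_threeAdic_of_semistable)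
    (h12 : Kato2004.thm12_4) (hns' : Kato2004.exists_multDivisibilityInputs_nonsplit_contra)
    (hsp' : Kato2004.exists_multDivisibilityInputs_split_contra)
    (hfine' : Kato2004.exists_multDivisibilityInputs_fine_contra)
    (hGs : Greenberg1999.thm41Analogue_charValue_rankZero_split_baseChange_anyPrime)
    (hGn : Greenberg1999.thm41Analogue_charValue_rankZero_numberField)
    (hGZK : rank_eq_analyticRank_of_analyticRank_le_one) (hGS : greenberg_stevens (W := W) (p := p))
    (hX : ClassX11a W p) (hp3 : p = 3)
    (hgoodA : A.HasGoodReductionAtPrime p) (hordA : ¬ (p : ℤ) ∣ A.frobeniusTrace p)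
    (hiso : ∃ e : geomTorsion W (p : ℤ) ≃+ geomTorsion A (p : ℤ),
      ∀ (σ : Field.absoluteGaloisGroup ℚ) (P : geomTorsion W (p : ℤ)), e (σ • P) = σ • e P) :
    MissingLowerBoundAt W p := by
  by_cases hsurj : Surj W p
  · have hsurj' : ∀ n : ℕ, W.HasSurjectiveModNGaloisRep (p ^ n : ℕ) := by
      subst hp3
      exact h20 W (Or.inr hX.mult) hsurj
    exact hX.missingLowerBoundAt_three_of_partner_of_multDivisibilityAt_of_theoremB_of_greenberg A hNf hEPW hYZ hTa hMz
      hGs hGn hGZK hGS hp3 (OddChain.multDivisibilityAt_of_kato_of_surjective_pow hKato hX.ne_two hX.mult hsurj')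
      hgoodA hordA hiso
  · have hμ : X11a.MuAnZeroAt W p := by
      subst hp3
      exact MultThreeMuAn.muAnZeroAt_three_of_mult_of_irr hMz W hX.mult hX.irr
    exact hX.missingLowerBoundAt_three_of_partner_of_multDivisibilityAt_of_theoremB_of_greenberg A hNf hEPW hYZ hTa hMz
      hGs hGn hGZK hGS hp3
      (X11b.multDivisibilityAt_of_katoFacts_of_muAnZeroAt_contra_of_mazur Kato2004.nonempty_iwasawaH1Data_holds h12 hNf
        hns' hsp' hfine' hMz W p hX.ne_two hX.mult hX.irr hsurj hμ)
      hgoodA hordA hiso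

end Doors

/-! ### §2 The `p = 3` deep statement and item 23178's text, without Stein–Wuthrich Thm. 6.1 -/

/-- **The lower half at every DEEP X11a pair with `p = 3`** from r17's `p = 3` children with the two SW 6.1 facts replaced
by Greenberg's rank-`0` formula ×2: finite flat at `3` ⟶ the Hesse-pencil partner (`Birth.exists_goodOrdinary_threeCongruent_partner`,
fact-free) and §1; très ramifié ⟶ Mazur's statement at the pair (`hMC3` = the registered r17 text
`stub_mazurMCAtTresRamifieThree` VERBATIM, OPEN) through p666636's door
`ClassX11a.missingLowerBoundAt_of_mazurMainConjectureAt_of_greenberg`.  Verbatim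
`ThreePartner.lowerThreeDeep_of_partnerFF_of_mazurTR_of_facts` (p646859) with `hJs` ∕ `hJn` ⟶ `hGs` ∕ `hGn`.  CONDITIONAL.
[cite: Fisher2012Hessian, Thm. 13.2 (n = 3)] [cite: EmertonPollackWeston2006, Thm. 1, Cor. 5.1.4]
[cite: GreenbergLNM1716, §4 (pp. 112–113)] [cite: Skinner2016PacificMC, Thm. A (shape only; printed under (ram))] -/
theorem lowerThreeDeep_of_partnerFF_of_mazurTR_of_greenberg_of_facts
    (hNf : exists_isNewformOf)
    (hKato : kato_charIdeal_dvd_multiplicative_of_surjective)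
    (h12 : Kato2004.thm12_4) (hns' : Kato2004.exists_multDivisibilityInputs_nonsplit_contra)
    (hsp' : Kato2004.exists_multDivisibilityInputs_split_contra)
    (hfine' : Kato2004.exists_multDivisibilityInputs_fine_contra)
    (hMz : mazur_not_dvd_maninConstant_of_odd)
    (hGs : Greenberg1999.thm41Analogue_charValue_rankZero_split_baseChange_anyPrime)
    (hGn : Greenberg1999.thm41Analogue_charValue_rankZero_numberField)
    (hGZK : rank_eq_analyticRank_of_analyticRank_le_one)
    (hGS : ∀ (W : WeierstrassCurve ℚ) [W.IsElliptic] [W.IsGloballyMinimal] (p : ℕ) [Fact p.Prime],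
      p ≠ 2 → greenberg_stevens (W := W) (p := p))
    (hEPW : cor514_transfer_of_goodOrdinary_odd)
    (hYZ : YanZhu2026.thm49_charIdeal_eq_padicLFunction) (hTa : thm1_muAlg_transfer_goodOrdinary_of_mult_odd)
    (hMC3 : ∀ (W : WeierstrassCurve ℚ) [W.IsElliptic] [W.IsGloballyMinimal] (p : ℕ) [Fact p.Prime],
      ClassX11a W p → p = 3 → ¬ X11a.ShaAnUnit W p → ¬ p ∣ padicValInt p W.minimalDiscriminantInt →
      X2.MazurMainConjectureAt W p) :
    ∀ (W : WeierstrassCurve ℚ) [W.IsElliptic] [W.IsGloballyMinimal] (p : ℕ) [Fact p.Prime],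
      ClassX11a W p → p = 3 → ¬ X11a.ShaAnUnit W p → MissingLowerBoundAt W p := by
  intro W _ _ p _ hX hp3 hu
  by_cases hff : p ∣ padicValInt p W.minimalDiscriminantInt
  · subst hp3
    obtain ⟨A, hAE, hAM, hgoodA, hordA, e, he⟩ :=
      Birth.exists_goodOrdinary_threeCongruent_partner W hX.mult (by exact_mod_cast hff)
    exact hX.missingLowerBoundAt_three_of_partner_of_contraFacts_of_theoremB_of_greenberg A hNf hEPW hYZ hTa hMz hKato
      Wuthrich2014.lemma20_surjective_threeAdic_of_semistable_holds h12 hns' hsp' hfine' hGs hGn hGZK (hGS W 3 hX.ne_two)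
      rfl hgoodA (by exact_mod_cast hordA) ⟨e, he⟩
  · exact hX.missingLowerBoundAt_of_mazurMainConjectureAt_of_greenberg hNf hGs hGn hGZK (hGS W p hX.ne_two)
      (hMC3 W p hX hp3 hu hff)

/-- **Item stmt-BirchSwinnertonDyer-23178's text `X11aLowerHalfAtThree` (`∀ V, ClassX11a V 3 → MissingLowerBoundAt V 3`, = the
lead's r18 child `stub_x11aLowerHalfAtThree` VERBATIM) from r17's `p = 3` children with Stein–Wuthrich 6.1 replaced by
Greenberg's rank-`0` formula ×2** — the previous theorem read at the literal prime (unit pairs free).  Compare the lead's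
turnkey `Birth.lowerAtThree_of_children_r17_three (h9) (h2L) (hQ3) (hMC3)` (p663752): the nine's two SW 6.1 conjuncts are
not binders here.  CONDITIONAL; closes nothing (23178 has no registered line; this is a door, not a claim).
[cite: GreenbergLNM1716, §4 (pp. 112–113)] [cite: Skinner2016PacificMC, Thm. A (shape only; printed under (ram))]
[cite: Miller2011LMS, Def. 1.1 (arXiv:1010.2431 p. 3)] -/
theorem lowerAtThree_of_partnerFF_of_mazurTR_of_greenberg_of_facts
    (hNf : exists_isNewformOf)
    (hKato : kato_charIdeal_dvd_multiplicative_of_surjective)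
    (h12 : Kato2004.thm12_4) (hns' : Kato2004.exists_multDivisibilityInputs_nonsplit_contra)
    (hsp' : Kato2004.exists_multDivisibilityInputs_split_contra)
    (hfine' : Kato2004.exists_multDivisibilityInputs_fine_contra)
    (hMz : mazur_not_dvd_maninConstant_of_odd)
    (hGs : Greenberg1999.thm41Analogue_charValue_rankZero_split_baseChange_anyPrime)
    (hGn : Greenberg1999.thm41Analogue_charValue_rankZero_numberField)
    (hGZK : rank_eq_analyticRank_of_analyticRank_le_one)
    (hGS : ∀ (W : WeierstrassCurve ℚ) [W.IsElliptic] [W.IsGloballyMinimal] (p : ℕ) [Fact p.Prime],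
      p ≠ 2 → greenberg_stevens (W := W) (p := p))
    (hEPW : cor514_transfer_of_goodOrdinary_odd)
    (hYZ : YanZhu2026.thm49_charIdeal_eq_padicLFunction) (hTa : thm1_muAlg_transfer_goodOrdinary_of_mult_odd)
    (hMC3 : ∀ (W : WeierstrassCurve ℚ) [W.IsElliptic] [W.IsGloballyMinimal] (p : ℕ) [Fact p.Prime],
      ClassX11a W p → p = 3 → ¬ X11a.ShaAnUnit W p → ¬ p ∣ padicValInt p W.minimalDiscriminantInt →
      X2.MazurMainConjectureAt W p) :
    ∀ (V : WeierstrassCurve ℚ) [V.IsElliptic] [V.IsGloballyMinimal], ClassX11a V 3 → MissingLowerBoundAt V 3 := by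
  intro V _ _ hX
  by_cases hu : X11a.ShaAnUnit V 3
  · exact x11a_missingLowerBoundAt_of_shaAnUnit hu
  · exact lowerThreeDeep_of_partnerFF_of_mazurTR_of_greenberg_of_facts hNf hKato h12 hns' hsp' hfine' hMz hGs hGn hGZK hGS
      hEPW hYZ hTa hMC3 V 3 hX rfl hu

/-! ### §3 Crux L BY NAME in line r17's shape, Stein–Wuthrich Thm. 6.1 out of the whole cone -/

/-- **Crux `X11aLowerHalf` BY NAME (`Theses.PrintX11a.X11aLowerHalf`, item 19064) from line r17's five children with the shared
nine's two Stein–Wuthrich 6.1 conjuncts replaced by Greenberg's rank-`0` formula ×2**: binders = the other SEVEN of the nine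
(GS at odd `p`, Kato 12.4, modularity, Kato §17.13 `_contra` ×3, Mazur 4.1), the two Greenberg facts, r17's two-fact child
(Kato–Wuthrich A32, GZK), its three partner facts (EPW 5.1.4, Yan–Zhu 4.9, EPW Thm. 1 alg), and its two research texts
`hMC3` ∕ `hMC5` VERBATIM — composed as (§2 at `p = 3`) + (p666636's `p ≥ 5` slice) through p666636's r18-shaped glue.
Compare the lead's `Birth.x11aLowerHalf_of_children_r17 (h9) (h2L) (hQ3) (hMC5) (hMC3)` (p656106): same research content,
SW 6.1 no longer in the cone.  CONDITIONAL; closes nothing; BSD is not proved.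
[cite: GreenbergLNM1716, §4 (pp. 112–113)] [cite: Skinner2016PacificMC, Thm. A (shape only; printed under (ram))]
[cite: Kato2004Asterisque, Thm. 12.4, §17.13] [cite: EmertonPollackWeston2006, Thm. 1, Cor. 5.1.4] [cite: Miller2011LMS, Def. 1.1] -/
theorem x11aLowerHalf_of_children_r17_of_greenberg
    (hNf : exists_isNewformOf)
    (hGs : Greenberg1999.thm41Analogue_charValue_rankZero_split_baseChange_anyPrime)
    (hGn : Greenberg1999.thm41Analogue_charValue_rankZero_numberField)
    (hGZK : rank_eq_analyticRank_of_analyticRank_le_one)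
    (hGS : ∀ (W : WeierstrassCurve ℚ) [W.IsElliptic] [W.IsGloballyMinimal] (p : ℕ) [Fact p.Prime],
      p ≠ 2 → greenberg_stevens (W := W) (p := p))
    (hKato : kato_charIdeal_dvd_multiplicative_of_surjective)
    (h12 : Kato2004.thm12_4) (hns' : Kato2004.exists_multDivisibilityInputs_nonsplit_contra)
    (hsp' : Kato2004.exists_multDivisibilityInputs_split_contra)
    (hfine' : Kato2004.exists_multDivisibilityInputs_fine_contra)
    (hMz : mazur_not_dvd_maninConstant_of_odd)
    (hEPW : cor514_transfer_of_goodOrdinary_odd)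
    (hYZ : YanZhu2026.thm49_charIdeal_eq_padicLFunction) (hTa : thm1_muAlg_transfer_goodOrdinary_of_mult_odd)
    (hMC3 : ∀ (W : WeierstrassCurve ℚ) [W.IsElliptic] [W.IsGloballyMinimal] (p : ℕ) [Fact p.Prime],
      ClassX11a W p → p = 3 → ¬ X11a.ShaAnUnit W p → ¬ p ∣ padicValInt p W.minimalDiscriminantInt →
      X2.MazurMainConjectureAt W p)
    (hMC5 : ∀ (W : WeierstrassCurve ℚ) [W.IsElliptic] [W.IsGloballyMinimal] (p : ℕ) [Fact p.Prime],
      ClassX11a W p → 5 ≤ p → ¬ X11a.ShaAnUnit W p → X2.MazurMainConjectureAt W p) :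
    Summit.BirchSwinnertonDyer.BirchSwinnertonDyer.Theses.PrintX11a.X11aLowerHalf :=
  x11aLowerHalf_of_lowerAtThree_of_mazurMCAtDeepFive_of_greenberg_of_threeFacts
    (lowerAtThree_of_partnerFF_of_mazurTR_of_greenberg_of_facts hNf hKato h12 hns' hsp' hfine' hMz hGs hGn hGZK hGS hEPW hYZ
      hTa hMC3)
    hNf hGs hGn hGZK hGS hMC5

end Summit.BirchSwinnertonDyer.BirchSwinnertonDyer.Theorems.GreenbergRankZero

end
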